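import Summits.Ventures.WeilGRH.UniformConductorFloorCellsOne
import HarnessLib

/-!
# GRH arm (rh-explicit, venture WeilGRH): the cell certificate at `t = log 2` — every character mod `q ≥ 40`

Cell `rh-explicit`, WEIL TRACK — GRH ARM (weil-grh-1).  Instance of `UniformFloor.weilPositivityOnChar_of_phi_budget` at
`t = log 2` (the two-prime window, `n = 2, 3`): `J = 40` cells (`δ = (log 2)/20`, so `s_2 = 20` exactly, `s_3 = 31`), and a
`φ`-certificate with **`ρ = 0.901`** (shift-by-shift budget: `1.1244`).  Consequences: `WeilPositivityOnChar χ (log 2)` for EVERY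
character of EVERY modulus **`q ≥ 40`** (even `40`, odd `24`; the tree's `ζ`-transfer floor is `50`, `ThirdPrimeReflectionRungs.lean`).

## References

* A. Weil (1952), (11) and the «lemme» p. 262 [Weil1952FormulesExplicites]; H. Yoshida (1992) §2, §6 [Yoshida1992].
-/

noncomputable section

open Complex Filter Set MeasureTheory
open scoped Real Topology ComplexConjugate ArithmeticFunction.vonMangoldt

namespace Summit.Ventures.WeilGRH

open Literature.NumberTheory.LFunctions

namespace UniformFloor

variable {q : ℕ}


/-! ## Shift brackets at `t = log 2`, `J = 40` -/

/-- `s_n δ ≤ log n ≤ (s_n + 1)δ`, `δ = (log 2)/20`: `s_2 = 20` (`log 2 = 20δ`), `s_3 = 31` (`31 log 2 ≤ 20 log 3 ≤ 32 log 2`).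
[folklore] -/
theorem logtwo40_shifts : ∀ n ∈ Finset.range (3 + 1),
    ((sLt40 n : ℤ) : ℝ) * (2 * Real.log 2 / ((40 : ℕ) : ℝ)) ≤ Real.log n ∧
      Real.log n ≤ (((sLt40 n : ℤ) : ℝ) + 1) * (2 * Real.log 2 / ((40 : ℕ) : ℝ)) := by
  intro n hn
  have hn4 : n < 4 := by have := Finset.mem_range.1 hn; omega
  have h2 := Real.log_two_gt_d9; have h2' := Real.log_two_lt_d9
  have h3 := Real.log_three_gt_d9; have h3' := Real.log_three_lt_d9
  interval_cases n
  · norm_num [sLt40]; linarith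
  · norm_num [sLt40]; linarith
  · norm_num [sLt40]; constructor <;> linarith
  · norm_num [sLt40]; constructor <;> linarith

/-! ## The certificate, cell by cell -/
/-- `37/125 ≤ φ_j` on `[0, 40)`. [folklore] -/
theorem logtwo40_philo : ∀ i : ℤ, 0 ≤ i → i < ((40 : ℕ) : ℤ) → (37 / 125 : ℝ) ≤ phiLt40 i := by
  intro i h0 h1
  push_cast at h1
  interval_cases i <;> norm_num [phiLt40]

/-- `φ_j ≤ 1`. [folklore] -/
theorem logtwo40_phihi : ∀ i : ℤ, phiLt40 i ≤ (1 : ℝ) := by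
  intro i
  by_cases h : 0 ≤ i ∧ i < 40
  · obtain ⟨h0, h1⟩ := h
    interval_cases i <;> norm_num [phiLt40]
  · simp only [phiLt40, if_neg h]
    norm_num

/-- `φ_j = 0` off `[0, 40)`. [folklore] -/
theorem logtwo40_phiout : ∀ i : ℤ, i < 0 ∨ ((40 : ℕ) : ℤ) ≤ i → phiLt40 i = 0 := by
  intro i hi
  have h : ¬ (0 ≤ i ∧ i < 40) := by omega
  simp only [phiLt40, if_neg h]

/-- Cell `0` of the `logtwo40` certificate (`ρ = 901/1000`). [folklore] -/
theorem logtwo40_cell_0 :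
    ∑ n ∈ Finset.range (3 + 1), wbar7 n *
      (max (phiLt40 (((0 : ℕ) : ℤ) - sLt40 n - 1)) (phiLt40 (((0 : ℕ) : ℤ) - sLt40 n)) +
        max (phiLt40 (((0 : ℕ) : ℤ) + sLt40 n)) (phiLt40 (((0 : ℕ) : ℤ) + sLt40 n + 1))) ≤
      (901 / 1000 : ℝ) * phiLt40 ((0 : ℕ) : ℤ) := by
  simp only [Finset.sum_range_succ, Finset.sum_range_zero, wbar7, phiLt40, sLt40]
  norm_num

/-- Cell `1` of the `logtwo40` certificate (`ρ = 901/1000`). [folklore] -/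
theorem logtwo40_cell_1 :
    ∑ n ∈ Finset.range (3 + 1), wbar7 n *
      (max (phiLt40 (((1 : ℕ) : ℤ) - sLt40 n - 1)) (phiLt40 (((1 : ℕ) : ℤ) - sLt40 n)) +
        max (phiLt40 (((1 : ℕ) : ℤ) + sLt40 n)) (phiLt40 (((1 : ℕ) : ℤ) + sLt40 n + 1))) ≤
      (901 / 1000 : ℝ) * phiLt40 ((1 : ℕ) : ℤ) := by
  simp only [Finset.sum_range_succ, Finset.sum_range_zero, wbar7, phiLt40, sLt40]
  norm_num

/-- Cell `2` of the `logtwo40` certificate (`ρ = 901/1000`). [folklore] -/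
theorem logtwo40_cell_2 :
    ∑ n ∈ Finset.range (3 + 1), wbar7 n *
      (max (phiLt40 (((2 : ℕ) : ℤ) - sLt40 n - 1)) (phiLt40 (((2 : ℕ) : ℤ) - sLt40 n)) +
        max (phiLt40 (((2 : ℕ) : ℤ) + sLt40 n)) (phiLt40 (((2 : ℕ) : ℤ) + sLt40 n + 1))) ≤
      (901 / 1000 : ℝ) * phiLt40 ((2 : ℕ) : ℤ) := by
  simp only [Finset.sum_range_succ, Finset.sum_range_zero, wbar7, phiLt40, sLt40]
  norm_num

/-- Cell `3` of the `logtwo40` certificate (`ρ = 901/1000`). [folklore] -/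
theorem logtwo40_cell_3 :
    ∑ n ∈ Finset.range (3 + 1), wbar7 n *
      (max (phiLt40 (((3 : ℕ) : ℤ) - sLt40 n - 1)) (phiLt40 (((3 : ℕ) : ℤ) - sLt40 n)) +
        max (phiLt40 (((3 : ℕ) : ℤ) + sLt40 n)) (phiLt40 (((3 : ℕ) : ℤ) + sLt40 n + 1))) ≤
      (901 / 1000 : ℝ) * phiLt40 ((3 : ℕ) : ℤ) := by
  simp only [Finset.sum_range_succ, Finset.sum_range_zero, wbar7, phiLt40, sLt40]
  norm_num

/-- Cell `4` of the `logtwo40` certificate (`ρ = 901/1000`). [folklore] -/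
theorem logtwo40_cell_4 :
    ∑ n ∈ Finset.range (3 + 1), wbar7 n *
      (max (phiLt40 (((4 : ℕ) : ℤ) - sLt40 n - 1)) (phiLt40 (((4 : ℕ) : ℤ) - sLt40 n)) +
        max (phiLt40 (((4 : ℕ) : ℤ) + sLt40 n)) (phiLt40 (((4 : ℕ) : ℤ) + sLt40 n + 1))) ≤
      (901 / 1000 : ℝ) * phiLt40 ((4 : ℕ) : ℤ) := by
  simp only [Finset.sum_range_succ, Finset.sum_range_zero, wbar7, phiLt40, sLt40]
  norm_num

/-- Cell `5` of the `logtwo40` certificate (`ρ = 901/1000`). [folklore] -/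
theorem logtwo40_cell_5 :
    ∑ n ∈ Finset.range (3 + 1), wbar7 n *
      (max (phiLt40 (((5 : ℕ) : ℤ) - sLt40 n - 1)) (phiLt40 (((5 : ℕ) : ℤ) - sLt40 n)) +
        max (phiLt40 (((5 : ℕ) : ℤ) + sLt40 n)) (phiLt40 (((5 : ℕ) : ℤ) + sLt40 n + 1))) ≤
      (901 / 1000 : ℝ) * phiLt40 ((5 : ℕ) : ℤ) := by
  simp only [Finset.sum_range_succ, Finset.sum_range_zero, wbar7, phiLt40, sLt40]
  norm_num

/-- Cell `6` of the `logtwo40` certificate (`ρ = 901/1000`). [folklore] -/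
theorem logtwo40_cell_6 :
    ∑ n ∈ Finset.range (3 + 1), wbar7 n *
      (max (phiLt40 (((6 : ℕ) : ℤ) - sLt40 n - 1)) (phiLt40 (((6 : ℕ) : ℤ) - sLt40 n)) +
        max (phiLt40 (((6 : ℕ) : ℤ) + sLt40 n)) (phiLt40 (((6 : ℕ) : ℤ) + sLt40 n + 1))) ≤
      (901 / 1000 : ℝ) * phiLt40 ((6 : ℕ) : ℤ) := by
  simp only [Finset.sum_range_succ, Finset.sum_range_zero, wbar7, phiLt40, sLt40]
  norm_num

/-- Cell `7` of the `logtwo40` certificate (`ρ = 901/1000`). [folklore] -/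
theorem logtwo40_cell_7 :
    ∑ n ∈ Finset.range (3 + 1), wbar7 n *
      (max (phiLt40 (((7 : ℕ) : ℤ) - sLt40 n - 1)) (phiLt40 (((7 : ℕ) : ℤ) - sLt40 n)) +
        max (phiLt40 (((7 : ℕ) : ℤ) + sLt40 n)) (phiLt40 (((7 : ℕ) : ℤ) + sLt40 n + 1))) ≤
      (901 / 1000 : ℝ) * phiLt40 ((7 : ℕ) : ℤ) := by
  simp only [Finset.sum_range_succ, Finset.sum_range_zero, wbar7, phiLt40, sLt40]
  norm_num

/-- Cell `8` of the `logtwo40` certificate (`ρ = 901/1000`). [folklore] -/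
theorem logtwo40_cell_8 :
    ∑ n ∈ Finset.range (3 + 1), wbar7 n *
      (max (phiLt40 (((8 : ℕ) : ℤ) - sLt40 n - 1)) (phiLt40 (((8 : ℕ) : ℤ) - sLt40 n)) +
        max (phiLt40 (((8 : ℕ) : ℤ) + sLt40 n)) (phiLt40 (((8 : ℕ) : ℤ) + sLt40 n + 1))) ≤
      (901 / 1000 : ℝ) * phiLt40 ((8 : ℕ) : ℤ) := by
  simp only [Finset.sum_range_succ, Finset.sum_range_zero, wbar7, phiLt40, sLt40]
  norm_num

/-- Cell `9` of the `logtwo40` certificate (`ρ = 901/1000`). [folklore] -/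
theorem logtwo40_cell_9 :
    ∑ n ∈ Finset.range (3 + 1), wbar7 n *
      (max (phiLt40 (((9 : ℕ) : ℤ) - sLt40 n - 1)) (phiLt40 (((9 : ℕ) : ℤ) - sLt40 n)) +
        max (phiLt40 (((9 : ℕ) : ℤ) + sLt40 n)) (phiLt40 (((9 : ℕ) : ℤ) + sLt40 n + 1))) ≤
      (901 / 1000 : ℝ) * phiLt40 ((9 : ℕ) : ℤ) := by
  simp only [Finset.sum_range_succ, Finset.sum_range_zero, wbar7, phiLt40, sLt40]
  norm_num

/-- Cell `10` of the `logtwo40` certificate (`ρ = 901/1000`). [folklore] -/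
theorem logtwo40_cell_10 :
    ∑ n ∈ Finset.range (3 + 1), wbar7 n *
      (max (phiLt40 (((10 : ℕ) : ℤ) - sLt40 n - 1)) (phiLt40 (((10 : ℕ) : ℤ) - sLt40 n)) +
        max (phiLt40 (((10 : ℕ) : ℤ) + sLt40 n)) (phiLt40 (((10 : ℕ) : ℤ) + sLt40 n + 1))) ≤
      (901 / 1000 : ℝ) * phiLt40 ((10 : ℕ) : ℤ) := by
  simp only [Finset.sum_range_succ, Finset.sum_range_zero, wbar7, phiLt40, sLt40]
  norm_num

/-- Cell `11` of the `logtwo40` certificate (`ρ = 901/1000`). [folklore] -/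
theorem logtwo40_cell_11 :
    ∑ n ∈ Finset.range (3 + 1), wbar7 n *
      (max (phiLt40 (((11 : ℕ) : ℤ) - sLt40 n - 1)) (phiLt40 (((11 : ℕ) : ℤ) - sLt40 n)) +
        max (phiLt40 (((11 : ℕ) : ℤ) + sLt40 n)) (phiLt40 (((11 : ℕ) : ℤ) + sLt40 n + 1))) ≤
      (901 / 1000 : ℝ) * phiLt40 ((11 : ℕ) : ℤ) := by
  simp only [Finset.sum_range_succ, Finset.sum_range_zero, wbar7, phiLt40, sLt40]
  norm_num

/-- Cell `12` of the `logtwo40` certificate (`ρ = 901/1000`). [folklore] -/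
theorem logtwo40_cell_12 :
    ∑ n ∈ Finset.range (3 + 1), wbar7 n *
      (max (phiLt40 (((12 : ℕ) : ℤ) - sLt40 n - 1)) (phiLt40 (((12 : ℕ) : ℤ) - sLt40 n)) +
        max (phiLt40 (((12 : ℕ) : ℤ) + sLt40 n)) (phiLt40 (((12 : ℕ) : ℤ) + sLt40 n + 1))) ≤
      (901 / 1000 : ℝ) * phiLt40 ((12 : ℕ) : ℤ) := by
  simp only [Finset.sum_range_succ, Finset.sum_range_zero, wbar7, phiLt40, sLt40]
  norm_num

/-- Cell `13` of the `logtwo40` certificate (`ρ = 901/1000`). [folklore] -/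
theorem logtwo40_cell_13 :
    ∑ n ∈ Finset.range (3 + 1), wbar7 n *
      (max (phiLt40 (((13 : ℕ) : ℤ) - sLt40 n - 1)) (phiLt40 (((13 : ℕ) : ℤ) - sLt40 n)) +
        max (phiLt40 (((13 : ℕ) : ℤ) + sLt40 n)) (phiLt40 (((13 : ℕ) : ℤ) + sLt40 n + 1))) ≤
      (901 / 1000 : ℝ) * phiLt40 ((13 : ℕ) : ℤ) := by
  simp only [Finset.sum_range_succ, Finset.sum_range_zero, wbar7, phiLt40, sLt40]
  norm_num

/-- Cell `14` of the `logtwo40` certificate (`ρ = 901/1000`). [folklore] -/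
theorem logtwo40_cell_14 :
    ∑ n ∈ Finset.range (3 + 1), wbar7 n *
      (max (phiLt40 (((14 : ℕ) : ℤ) - sLt40 n - 1)) (phiLt40 (((14 : ℕ) : ℤ) - sLt40 n)) +
        max (phiLt40 (((14 : ℕ) : ℤ) + sLt40 n)) (phiLt40 (((14 : ℕ) : ℤ) + sLt40 n + 1))) ≤
      (901 / 1000 : ℝ) * phiLt40 ((14 : ℕ) : ℤ) := by
  simp only [Finset.sum_range_succ, Finset.sum_range_zero, wbar7, phiLt40, sLt40]
  norm_num

/-- Cell `15` of the `logtwo40` certificate (`ρ = 901/1000`). [folklore] -/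
theorem logtwo40_cell_15 :
    ∑ n ∈ Finset.range (3 + 1), wbar7 n *
      (max (phiLt40 (((15 : ℕ) : ℤ) - sLt40 n - 1)) (phiLt40 (((15 : ℕ) : ℤ) - sLt40 n)) +
        max (phiLt40 (((15 : ℕ) : ℤ) + sLt40 n)) (phiLt40 (((15 : ℕ) : ℤ) + sLt40 n + 1))) ≤
      (901 / 1000 : ℝ) * phiLt40 ((15 : ℕ) : ℤ) := by
  simp only [Finset.sum_range_succ, Finset.sum_range_zero, wbar7, phiLt40, sLt40]
  norm_num

/-- Cell `16` of the `logtwo40` certificate (`ρ = 901/1000`). [folklore] -/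
theorem logtwo40_cell_16 :
    ∑ n ∈ Finset.range (3 + 1), wbar7 n *
      (max (phiLt40 (((16 : ℕ) : ℤ) - sLt40 n - 1)) (phiLt40 (((16 : ℕ) : ℤ) - sLt40 n)) +
        max (phiLt40 (((16 : ℕ) : ℤ) + sLt40 n)) (phiLt40 (((16 : ℕ) : ℤ) + sLt40 n + 1))) ≤
      (901 / 1000 : ℝ) * phiLt40 ((16 : ℕ) : ℤ) := by
  simp only [Finset.sum_range_succ, Finset.sum_range_zero, wbar7, phiLt40, sLt40]
  norm_num

/-- Cell `17` of the `logtwo40` certificate (`ρ = 901/1000`). [folklore] -/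
theorem logtwo40_cell_17 :
    ∑ n ∈ Finset.range (3 + 1), wbar7 n *
      (max (phiLt40 (((17 : ℕ) : ℤ) - sLt40 n - 1)) (phiLt40 (((17 : ℕ) : ℤ) - sLt40 n)) +
        max (phiLt40 (((17 : ℕ) : ℤ) + sLt40 n)) (phiLt40 (((17 : ℕ) : ℤ) + sLt40 n + 1))) ≤
      (901 / 1000 : ℝ) * phiLt40 ((17 : ℕ) : ℤ) := by
  simp only [Finset.sum_range_succ, Finset.sum_range_zero, wbar7, phiLt40, sLt40]
  norm_num

/-- Cell `18` of the `logtwo40` certificate (`ρ = 901/1000`). [folklore] -/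
theorem logtwo40_cell_18 :
    ∑ n ∈ Finset.range (3 + 1), wbar7 n *
      (max (phiLt40 (((18 : ℕ) : ℤ) - sLt40 n - 1)) (phiLt40 (((18 : ℕ) : ℤ) - sLt40 n)) +
        max (phiLt40 (((18 : ℕ) : ℤ) + sLt40 n)) (phiLt40 (((18 : ℕ) : ℤ) + sLt40 n + 1))) ≤
      (901 / 1000 : ℝ) * phiLt40 ((18 : ℕ) : ℤ) := by
  simp only [Finset.sum_range_succ, Finset.sum_range_zero, wbar7, phiLt40, sLt40]
  norm_num

/-- Cell `19` of the `logtwo40` certificate (`ρ = 901/1000`). [folklore] -/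
theorem logtwo40_cell_19 :
    ∑ n ∈ Finset.range (3 + 1), wbar7 n *
      (max (phiLt40 (((19 : ℕ) : ℤ) - sLt40 n - 1)) (phiLt40 (((19 : ℕ) : ℤ) - sLt40 n)) +
        max (phiLt40 (((19 : ℕ) : ℤ) + sLt40 n)) (phiLt40 (((19 : ℕ) : ℤ) + sLt40 n + 1))) ≤
      (901 / 1000 : ℝ) * phiLt40 ((19 : ℕ) : ℤ) := by
  simp only [Finset.sum_range_succ, Finset.sum_range_zero, wbar7, phiLt40, sLt40]
  norm_num
end UniformFloor

end Summit.Ventures.WeilGRH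

end
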